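import Literature.NumberTheory.GaloisRepresentations.WeakAbelianDirectSummandRatLocAlgProofs
import Literature.NumberTheory.GaloisRepresentations.WeakAbelianDirectSummandCyclotomicProofs
import Literature.NumberTheory.GaloisRepresentations.FrobeniusDensityOneProofs
import Mathlib.NumberTheory.LSeries.PrimesInAP
import Mathlib.Analysis.Normed.Ring.Units
import HarnessLib

/-!
# Weak abelian direct summands over `ℚ`: a power of the character is a power of `χ_ℓ` (proved)

Topic `NumberTheory/GaloisRepresentations`; namespace
`Literature.NumberTheory.GaloisRepresentations`.  A *proofs* file (theorems only; no definition,
no named fact, no instance), sibling of `WeakAbelianDirectSummand.lean` (Böckle–Hui 2025, Thm. 1.1;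
named fact `exists_heckeCharacter_of_weaklyDivides`).

**Theorem** (`WeaklyDivides.exists_pow_eq_cyclotomic_pow_rat`).  Let `v` be a finite place of `ℚ`
with prime `ℓ = p_v`, `ρ : Γ_ℚ → GL_n(ℚ̄_ℓ)` an `E`-rational `ℓ`-adic representation and
`ψ : Γ_ℚ → GL_1(ℚ̄_ℓ)` a character weakly dividing `ρ`.  Then **`ψ^M = χ_ℓ^c`** for some `M ≥ 1`
and `c ∈ ℤ` (`χ_ℓ` the `ℓ`-adic cyclotomic character): `ψ(σ)^M = χ_ℓ(σ)^c` for every `σ ∈ Γ_ℚ`.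

This assembles, for `K = ℚ`, the first two steps of the printed proof of BH Thm. 1.1 (§2.7):
"there exists `N ∈ ℕ` such that `ψ_ℓ^N` is locally algebraic … Then the implication
(Loc-alg) ⇒ (`E`-rat) … implies the existence of a number field `E'` such that `ψ_ℓ^N` is
`E'`-rational" — over `ℚ` a locally algebraic `ℓ`-adic character is `χ_ℓ^c` up to a character of
finite order (Serre, Ch. III §1.2 with II §2.8: the algebraic characters of `T = 𝔾_m` are the
`x ↦ x^c`), and here the exponent `M` also kills the finite-order part.

Proof.  By the sibling `WeakAbelianDirectSummandRatLocAlgProofs` (BH Thm. 2.2 over `ℚ`):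
`Ψ(⟨u⟩_ℓ)^b = u^a` on `ℤ_ℓˣ` for the idele class character `Ψ = ψ ∘ Art_ℚ`.  Let
`Ψ_c = χ_ℓ ∘ Art_ℚ` be the idele class character of the cyclotomic character
(`FramedGaloisRep.exists_idelicCharacter`; `Ψ_c(⟨q⟩_q) = χ_ℓ(Frob_q) = q`).  Serre's product
formula (`IdelicCharacter.exists_pow_prod_map_localUnits_eq`) gives `(Ψ_c(⟨q⟩_ℓ) · q)^{N₁} = 1`
for the primes `q ≠ ℓ`, which are dense in `ℤ_ℓˣ` (Dirichlet's theorem on primes in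
progressions, `Nat.forall_exists_prime_gt_and_eq_mod`), so `(Ψ_c(⟨u⟩_ℓ) · u)^{N₁} = 1` on `ℤ_ℓˣ`.
Hence `Θ = Ψ^{b N₁} Ψ_c^{a N₁}` is trivial on `⟨ℤ_ℓˣ⟩` and unramified away from a finite set; the
product formula for `Θ` at a prime `q` shows `Θ(⟨q⟩_q)^{N₂} = 1`, i.e.
`ψ(Frob_q)^{b N₁ N₂} = q^{-a N₁ N₂} = χ_ℓ(Frob_q)^{-a N₁ N₂}` for almost all `q`, and the Frobenius
rigidity of continuous characters (`MonoidHom.eq_one_of_frobenius_eq_one_of_hasDirichletDensity_one`)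
gives `ψ^M = χ_ℓ^c` on all of `Γ_ℚ`.

## References

* G. Böckle, C.-Y. Hui, Math. Ann. 393 (2025), §2.4, §2.7. [BockleHui2025]
* J.-P. Serre, *Abelian ℓ-adic representations and elliptic curves* (1968), Ch. II §2.8,
  Ch. III §1.2, §3. [SerreAbelianLadic1968]
-/

noncomputable section

open scoped NumberField Polynomial Topology
open NumberField IsDedekindDomain IsDedekindDomain.HeightOneSpectrum Field Polynomial Filter
open Rat.HeightOneSpectrum

namespace Literature.NumberTheory.GaloisRepresentations

/-! ### Dirichlet: the primes are dense in `ℤ_ℓˣ` -/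

section Dense

variable {p : ℕ} [Fact p.Prime]

/-- **The prime numbers `q` outside any finite set are dense in `ℤ_ℓˣ`** (Dirichlet's theorem on
primes in arithmetic progressions mod `ℓ^k`, Mathlib `Nat.forall_exists_prime_gt_and_eq_mod`; the
units carry the subspace topology of the complete normed ring `ℤ_ℓ`). [folklore] -/
theorem PadicInt.dense_setOf_units_eq_prime {S : Set ℕ} (hS : S.Finite) :
    Dense {u : ℤ_[p]ˣ | ∃ q : ℕ, q.Prime ∧ q ∉ S ∧ ((u : ℤ_[p]) : ℚ_[p]) = q} := by
  have hp : p.Prime := Fact.out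
  have hp1 : (1 : ℝ) < p := by exact_mod_cast hp.one_lt
  obtain ⟨n₀, hn₀⟩ := hS.bddAbove
  rw [dense_iff_inter_open]
  intro U hU ⟨u₀, hu₀⟩
  -- `val '' U` is an open subset of `ℤ_ℓ` containing `u₀`
  have hUo : IsOpen (((↑) : ℤ_[p]ˣ → ℤ_[p]) '' U) := Units.isOpenEmbedding_val.isOpenMap U hU
  obtain ⟨ε, hε, hball⟩ := Metric.isOpen_iff.mp hUo (u₀ : ℤ_[p]) ⟨u₀, hu₀, rfl⟩
  -- a level `k` with `p^{-k} < ε`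
  obtain ⟨k, hk⟩ := exists_pow_lt_of_lt_one hε (inv_lt_one_of_one_lt₀ hp1)
  -- Dirichlet mod `p^k`
  haveI : NeZero (p ^ k) := ⟨pow_ne_zero k hp.ne_zero⟩
  have ha : IsUnit (PadicInt.toZModPow k (u₀ : ℤ_[p])) := (Units.isUnit u₀).map _
  obtain ⟨q, hqn, hq, hqa⟩ := Nat.forall_exists_prime_gt_and_eq_mod ha (max n₀ p)
  have hqS : q ∉ S := fun h => by
    have := hn₀ h
    omega
  -- `q` is close to `u₀`
  have hclose : ‖(q : ℤ_[p]) - u₀‖ < ε := by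
    have hmem : (q : ℤ_[p]) - u₀ ∈ (Ideal.span {(p : ℤ_[p]) ^ k} : Ideal ℤ_[p]) := by
      rw [← PadicInt.ker_toZModPow, RingHom.mem_ker, map_sub, map_natCast, hqa, sub_self]
    refine lt_of_le_of_lt ((PadicInt.norm_le_pow_iff_mem_span_pow _ k).mpr hmem) ?_
    rw [zpow_neg, zpow_natCast, ← inv_pow]
    exact hk
  have hmemU : (q : ℤ_[p]) ∈ ((↑) : ℤ_[p]ˣ → ℤ_[p]) '' U := hball (by
    rw [Metric.mem_ball, dist_eq_norm]; exact hclose)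
  obtain ⟨u, huU, huq'⟩ := hmemU
  refine ⟨u, huU, q, hq, hqS, ?_⟩
  rw [huq']
  exact PadicInt.coe_natCast q

end Dense

namespace FramedGaloisRep

attribute [local instance] Rat.fact_prime_natGenerator

/-! ### Places of `ℚ` and primes -/

/-- `p_v ∈ w ↔ w = v` for places `v, w` of `ℚ`. [folklore] -/
theorem natCast_natGenerator_mem_asIdeal_iff (v w : HeightOneSpectrum (𝓞 ℚ)) :
    ((natGenerator v : ℕ) : 𝓞 ℚ) ∈ w.asIdeal ↔ w = v := by
  rw [Rat.natCast_mem_asIdeal_iff,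
    Nat.prime_dvd_prime_iff_eq (prime_natGenerator w) (prime_natGenerator v)]
  exact ⟨fun h => Rat.natGenerator_injective h, fun h => by rw [h]⟩

/-- The global prime `p_w` is a uniformizer at `w`. [folklore] -/
theorem valued_globalToLocalUnits_primeUnit (w : HeightOneSpectrum (𝓞 ℚ)) :
    Valued.v ((globalToLocalUnits w (Rat.primeUnit w) : (w.adicCompletion ℚ)ˣ) :
      w.adicCompletion ℚ) = WithZero.exp (-1 : ℤ) := by
  rw [val_globalToLocalUnits, valued_algebraMap_adicCompletion, Rat.val_primeUnit]
  exact Rat.valuation_natGenerator w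

/-- The global prime `p_w` is a unit at every other place. [folklore] -/
theorem valuation_primeUnit_of_ne {w w' : HeightOneSpectrum (𝓞 ℚ)} (h : w' ≠ w) :
    w'.valuation ℚ (Rat.primeUnit w : ℚ) = 1 := by
  rw [Rat.val_primeUnit]
  exact Rat.valuation_natGenerator_of_ne h

/-! ### The main theorem -/

/-- **Over `ℚ`, a power of a weak abelian direct summand is a power of the cyclotomic character**
(BH Thm. 1.1, proof §2.7, Steps 1–2 for `K = ℚ`: `ψ^N` locally algebraic, hence `E'`-rational —
over `ℚ`, a power of `χ_ℓ`).  Let `v` be a place of `ℚ`, `ℓ = p_v`, `ρ : Γ_ℚ → GL_n(ℚ̄_ℓ)`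
`E`-rational and `ψ : Γ_ℚ → GL_1(ℚ̄_ℓ)` a character weakly dividing `ρ`.  Then there are
`M ≥ 1` and `c ∈ ℤ` with `ψ(σ)^M = χ_ℓ(σ)^c` (read in `ℚ̄_ℓ`) for every `σ ∈ Γ_ℚ`.
[cite: BockleHui2025, §2.7 (proof of Thm. 1.1, first two steps) with §2.4 and Thm. 2.2]
[cite: SerreAbelianLadic1968, Ch. III §1.2 and §3] -/
theorem WeaklyDivides.exists_pow_eq_cyclotomic_pow_rat (v : HeightOneSpectrum (𝓞 ℚ))
    {E : Type*} [Field E] [NumberField E] (e : E →+* PadicAlgCl (natGenerator v)) {n : ℕ}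
    {ρ : FramedGaloisRep ℚ (PadicAlgCl (natGenerator v)) n} (hρ : ρ.IsRationalOver e)
    {ψ : FramedGaloisRep ℚ (PadicAlgCl (natGenerator v)) 1} (h : ψ.WeaklyDivides ρ) :
    ∃ M : ℕ, 0 < M ∧ ∃ c : ℤ, ∀ σ : absoluteGaloisGroup ℚ,
      ((((ψ σ : GL (Fin 1) (PadicAlgCl (natGenerator v))) :
          Matrix (Fin 1) (Fin 1) (PadicAlgCl (natGenerator v))) 0 0)) ^ M =
        (algebraMap ℚ_[natGenerator v] (PadicAlgCl (natGenerator v))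
          (((GaloisRep.cyclotomicCharacter ℚ (natGenerator v) σ : ℤ_[natGenerator v]ˣ) :
            ℤ_[natGenerator v]) : ℚ_[natGenerator v])) ^ c := by
  classical
  set p : ℕ := natGenerator v with hp_def
  have hp : p.Prime := prime_natGenerator v
  have hpv : ((p : ℕ) : 𝓞 ℚ) ∈ v.asIdeal := (natCast_natGenerator_mem_asIdeal_iff v v).mpr rfl
  -- Step 1 over `ℚ` (BH Thm. 2.2): `Ψ⟨u⟩_v^b = u^a`
  obtain ⟨Ψ, hK, hae, b, hb, a, hba⟩ := WeaklyDivides.exists_pow_idelic_eq_pow_rat v e hρ h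
  -- the cyclotomic character and its idele class character
  obtain ⟨cyc, hcyc⟩ := exists_cyclotomic_padicAlgCl ℚ p
  obtain ⟨Ψc, hKc, hlocc⟩ := cyc.exists_idelicCharacter
  have hcunr : ∀ w : HeightOneSpectrum (𝓞 ℚ), w ≠ v → cyc.IsUnramifiedAt w := fun w hw =>
    isUnramifiedAt_of_cyclotomic cyc hcyc fun hmem =>
      hw ((natCast_natGenerator_mem_asIdeal_iff v w).mp hmem)
  have hcunits : ∀ w : HeightOneSpectrum (𝓞 ℚ), w ≠ v → ∀ u : (w.adicCompletionIntegers ℚ)ˣ,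
      Ψc (localUnits w (Units.map ((w.adicCompletionIntegers ℚ).subtype : _ →* _) u)) = 1 :=
    fun w hw => (hlocc w (hcunr w hw)).1
  -- `Ψc(⟨p_w⟩_w) = p_w` at every `w ≠ v`
  have hcfrob : ∀ w : HeightOneSpectrum (𝓞 ℚ), w ≠ v →
      ((Ψc (localUnits w (globalToLocalUnits w (Rat.primeUnit w))) : (PadicAlgCl p)ˣ) :
        PadicAlgCl p) = natGenerator w := by
    intro w hw
    have hnot : ((p : ℕ) : 𝓞 ℚ) ∉ w.asIdeal := fun hmem =>
      hw ((natCast_natGenerator_mem_asIdeal_iff v w).mp hmem)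
    obtain ⟨𝔓, h𝔓⟩ := w.primesAbove_nonempty
    obtain ⟨Φ, hΦ⟩ := HeightOneSpectrum.exists_isArithFrobAt_of_mem_primesAbove_holds h𝔓
    have h1 := (FramedGaloisRep.hasFrobCharpolyAt_iff_of_rank_one cyc w _).mp
      ((hlocc w (hcunr w hw)).2 _ (valued_globalToLocalUnits_primeUnit w)) 𝔓 h𝔓 Φ hΦ
    have h2 := (FramedGaloisRep.hasFrobCharpolyAt_iff_of_rank_one cyc w _).mp
      (hasFrobCharpolyAt_natCast_of_cyclotomic cyc hcyc hnot) 𝔓 h𝔓 Φ hΦ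
    rw [← h1, h2, Rat.residueCard_eq_natGenerator]
  -- Serre's formula for `Ψc`, unramified outside `{v}`
  obtain ⟨N₁, hN₁0, hN₁⟩ := IdelicCharacter.exists_pow_prod_map_localUnits_eq Ψc hKc {v}
    (fun w hw => hcunits w (fun h' => hw (Finset.mem_singleton.mpr h')))
  have hfilter1 : ({v} : Finset (HeightOneSpectrum (𝓞 ℚ))).filter
      (fun w => ((p : ℕ) : 𝓞 ℚ) ∈ w.asIdeal) = {v} := by
    ext w
    simp only [Finset.mem_filter, Finset.mem_singleton]
    exact ⟨fun h' => h'.1, fun h' => ⟨h', by rw [h']; exact hpv⟩⟩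
  -- `(Ψc⟨q⟩_v · q)^{N₁} = 1` for the primes `q ≠ p`
  have hcq : ∀ w : HeightOneSpectrum (𝓞 ℚ), w ≠ v →
      (((Ψc (localUnits v (globalToLocalUnits v (Rat.primeUnit w))) : (PadicAlgCl p)ˣ) :
        PadicAlgCl p) * natGenerator w) ^ N₁ = 1 := by
    intro w hw
    have hST : Disjoint ({v} : Finset (HeightOneSpectrum (𝓞 ℚ))) {w} := by
      rw [Finset.disjoint_singleton_left, Finset.mem_singleton]
      exact fun h' => hw h'.symm
    have hk : ∀ w' ∈ ({v} : Finset (HeightOneSpectrum (𝓞 ℚ))), ((p : ℕ) : 𝓞 ℚ) ∉ w'.asIdeal →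
        w'.valuation ℚ (Rat.primeUnit w : ℚ) = 1 := by
      intro w' hw' hpw'
      rw [Finset.mem_singleton] at hw'
      exact absurd (hw' ▸ hpv) hpw'
    have hkT : ∀ w' ∉ ({v} : Finset (HeightOneSpectrum (𝓞 ℚ))) ∪ {w},
        w'.valuation ℚ (Rat.primeUnit w : ℚ) = 1 := by
      intro w' hw'
      rw [Finset.mem_union, Finset.mem_singleton, Finset.mem_singleton, not_or] at hw'
      exact valuation_primeUnit_of_ne hw'.2
    have h1 := hN₁ (Rat.primeUnit w) hk {w} hST hkT
    rw [hfilter1, Finset.prod_singleton, Finset.prod_singleton, ← mul_pow] at h1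
    have h2 := congrArg (fun u : (PadicAlgCl p)ˣ => (u : PadicAlgCl p)) h1
    simp only [Units.val_pow_eq_pow_val, Units.val_mul, Units.val_one] at h2
    rw [hcfrob w hw] at h2
    exact h2
  -- transport to `ℤ_ℓˣ` and extend to all units by density
  let eZ : v.adicCompletionIntegers ℚ ≃+* ℤ_[p] :=
    (adicCompletionIntegers.padicIntEquiv v).toAlgEquiv.toRingEquiv
  have heZc : Continuous eZ.symm := (adicCompletionIntegers.padicIntEquiv v).symm.continuous
  have heZval : ∀ x : v.adicCompletionIntegers ℚ, ((eZ x : ℤ_[p]) : ℚ_[p]) =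
      Rat.toPadic v (x : v.adicCompletion ℚ) := fun x => rfl
  set θ : ℤ_[p]ˣ →* (v.adicCompletionIntegers ℚ)ˣ := Units.map eZ.symm.toMonoidHom with hθ_def
  have hθc : Continuous θ := Continuous.units_map _ heZc
  have hθval : ∀ u : ℤ_[p]ˣ, ((θ u : (v.adicCompletionIntegers ℚ)ˣ) :
      v.adicCompletionIntegers ℚ) = eZ.symm (u : ℤ_[p]) := fun u => rfl
  -- `θ` of the prime unit `p_w` is the global unit `p_w`
  have hθprime : ∀ (u : ℤ_[p]ˣ) (w : HeightOneSpectrum (𝓞 ℚ)),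
      ((u : ℤ_[p]) : ℚ_[p]) = natGenerator w →
      Units.map ((v.adicCompletionIntegers ℚ).subtype : _ →* _) (θ u) =
        globalToLocalUnits v (Rat.primeUnit w) := by
    intro u w hu
    have hu' : (u : ℤ_[p]) = (natGenerator w : ℤ_[p]) := by
      apply Subtype.ext
      rw [PadicInt.coe_natCast]
      exact hu
    apply Units.ext
    rw [Units.coe_map, val_globalToLocalUnits, Rat.val_primeUnit, map_natCast]
    change (((θ u : (v.adicCompletionIntegers ℚ)ˣ) : v.adicCompletionIntegers ℚ) :
      v.adicCompletion ℚ) = _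
    rw [hθval u, hu', map_natCast]
    rfl
  set ιp : ℚ_[p] →+* PadicAlgCl p := algebraMap ℚ_[p] (PadicAlgCl p) with hιp_def
  -- the continuous function `u ↦ (Ψc⟨θ u⟩_v · u)^{N₁}` on `ℤ_ℓˣ`
  set F : ℤ_[p]ˣ → PadicAlgCl p := fun u =>
    (((Ψc (localUnits v (Units.map ((v.adicCompletionIntegers ℚ).subtype : _ →* _) (θ u))) :
      (PadicAlgCl p)ˣ) : PadicAlgCl p) * ιp ((u : ℤ_[p]) : ℚ_[p])) ^ N₁ with hF_def
  have hFc : Continuous F := by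
    refine Continuous.pow (Continuous.mul ?_ ?_) N₁
    · exact Units.continuous_val.comp (Ψc.continuous.comp
        ((IdelicCharacter.continuous_localUnits_unitsMap v).comp hθc))
    · have hc1 : Continuous (fun x : ℤ_[p] => (x : ℚ_[p])) := continuous_subtype_val
      exact (continuous_algebraMap ℚ_[p] (PadicAlgCl p)).comp (hc1.comp Units.continuous_val)
  have hF1 : F = fun _ => 1 := by
    refine Continuous.ext_on (PadicInt.dense_setOf_units_eq_prime (S := {p})
      (Set.finite_singleton p)) hFc continuous_const ?_
    rintro u ⟨q, hq, hqp, hu⟩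
    have hqp' : q ≠ p := fun h' => hqp (h' ▸ Set.mem_singleton p)
    set w : HeightOneSpectrum (𝓞 ℚ) := (primesEquiv (R := 𝓞 ℚ)).symm ⟨q, hq⟩ with hw_def
    have hwq : natGenerator w = q :=
      congrArg Subtype.val ((primesEquiv (R := 𝓞 ℚ)).apply_symm_apply ⟨q, hq⟩)
    have hwv : w ≠ v := fun h' => hqp' (by rw [← hwq, h', ← hp_def])
    rw [← hwq] at hu
    change (((Ψc (localUnits v (Units.map ((v.adicCompletionIntegers ℚ).subtype : _ →* _)
      (θ u))) : (PadicAlgCl p)ˣ) : PadicAlgCl p) * ιp ((u : ℤ_[p]) : ℚ_[p])) ^ N₁ = 1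
    rw [hθprime u w hu, hu, map_natCast]
    exact hcq w hwv
  -- hence `(Ψc⟨u⟩_v · u)^{N₁} = 1` for every `u ∈ 𝒪_vˣ`
  have hcunit : ∀ u : (v.adicCompletionIntegers ℚ)ˣ,
      (((Ψc (localUnits v (Units.map ((v.adicCompletionIntegers ℚ).subtype : _ →* _) u)) :
        (PadicAlgCl p)ˣ) : PadicAlgCl p) *
          ιp (Rat.toPadic v ((u : v.adicCompletionIntegers ℚ) : v.adicCompletion ℚ))) ^ N₁
        = 1 := by
    intro u
    set u' : ℤ_[p]ˣ := Units.map eZ.toMonoidHom u with hu'_def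
    have hθu' : θ u' = u := by
      apply Units.ext
      rw [hθval u', hu'_def, Units.coe_map]
      exact eZ.symm_apply_apply _
    have := congrFun hF1 u'
    simp only [hF_def] at this
    rw [hθu'] at this
    rw [← heZval]
    exact this
  -- the character `Θ = Ψ^{b N₁} Ψc^{a N₁}`
  set Θ₀ : ideleGroup ℚ →* (PadicAlgCl p)ˣ :=
    { toFun := fun x => Ψ x ^ (b * N₁) * Ψc x ^ ((a : ℤ) * N₁)
      map_one' := by simp only [map_one, one_pow, one_zpow, mul_one]
      map_mul' := fun x y => by
        rw [map_mul, map_mul, mul_pow, mul_zpow, mul_mul_mul_comm] } with hΘ₀_def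
  have hΘ₀c : Continuous Θ₀ :=
    (Ψ.continuous.pow _).mul (Ψc.continuous.zpow _)
  set Θ : ideleGroup ℚ →ₜ* (PadicAlgCl p)ˣ := ⟨Θ₀, hΘ₀c⟩ with hΘ_def
  have hΘ : ∀ x, Θ x = Ψ x ^ (b * N₁) * Ψc x ^ ((a : ℤ) * N₁) := fun x => rfl
  have hΘK : ∀ x ∈ principalIdeles ℚ, Θ x = 1 := fun x hx => by
    rw [hΘ, hK x hx, hKc x hx, one_pow, one_zpow, mul_one]
  -- `Θ` kills `𝒪_vˣ`
  have hΘv : ∀ u : (v.adicCompletionIntegers ℚ)ˣ,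
      Θ (localUnits v (Units.map ((v.adicCompletionIntegers ℚ).subtype : _ →* _) u)) = 1 := by
    intro u
    apply Units.ext
    set t := ιp (Rat.toPadic v ((u : v.adicCompletionIntegers ℚ) : v.adicCompletion ℚ)) with ht
    set x := ((Ψ (localUnits v (Units.map ((v.adicCompletionIntegers ℚ).subtype : _ →* _) u)) :
      (PadicAlgCl p)ˣ) : PadicAlgCl p) with hx
    set y := ((Ψc (localUnits v (Units.map ((v.adicCompletionIntegers ℚ).subtype : _ →* _) u)) :
      (PadicAlgCl p)ˣ) : PadicAlgCl p) with hy
    have hu0 : ((u : v.adicCompletionIntegers ℚ) : v.adicCompletion ℚ) ≠ 0 := fun h0 =>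
      u.ne_zero (Subtype.ext h0)
    have ht0 : t ≠ 0 := by
      rw [ht, _root_.map_ne_zero, _root_.map_ne_zero]
      exact hu0
    have h1 : x ^ b = t ^ a := hba u
    have h2 : (y * t) ^ N₁ = 1 := hcunit u
    have e1 : x ^ (b * N₁) = t ^ ((a : ℤ) * N₁) := by
      rw [pow_mul, h1, ← zpow_natCast, ← zpow_mul]
    have e2 : t ^ ((a : ℤ) * N₁) * y ^ ((a : ℤ) * N₁) = ((y * t) ^ N₁) ^ a := by
      rw [← mul_zpow, mul_comm (a : ℤ), zpow_mul, zpow_natCast, mul_comm t y]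
    rw [hΘ, Units.val_mul, Units.val_pow_eq_pow_val, Units.val_zpow_eq_zpow_val, Units.val_one,
      ← hx, ← hy, e1, e2, h2, one_zpow]
  -- the exceptional places: bad places of `ψ`/`Ψ` and `v`
  have hfin := Filter.eventually_cofinite.mp hae
  set S₀ : Finset (HeightOneSpectrum (𝓞 ℚ)) := hfin.toFinset ∪ {v} with hS₀
  have hvS₀ : v ∈ S₀ := Finset.mem_union_right _ (Finset.mem_singleton_self v)
  have hgood : ∀ w ∉ S₀, (ψ.IsUnramifiedAt w ∧
      (∀ u : (w.adicCompletionIntegers ℚ)ˣ,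
        Ψ (localUnits w (Units.map ((w.adicCompletionIntegers ℚ).subtype : _ →* _) u)) = 1) ∧
      ∀ ϖ : (w.adicCompletion ℚ)ˣ,
        Valued.v (ϖ : w.adicCompletion ℚ) = WithZero.exp (-1 : ℤ) →
          ψ.HasFrobCharpolyAt w (X - C ((Ψ (localUnits w ϖ) : (PadicAlgCl p)ˣ) :
            PadicAlgCl p))) ∧ w ≠ v := by
    intro w hw
    refine ⟨?_, fun h' => hw (h' ▸ hvS₀)⟩
    by_contra hbad
    exact hw (Finset.mem_union_left _ ((Set.Finite.mem_toFinset _).mpr hbad))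
  have hΘunits : ∀ w ∉ S₀, ∀ u : (w.adicCompletionIntegers ℚ)ˣ,
      Θ (localUnits w (Units.map ((w.adicCompletionIntegers ℚ).subtype : _ →* _) u)) = 1 := by
    intro w hw u
    rw [hΘ, (hgood w hw).1.2.1 u, hcunits w (hgood w hw).2 u, one_pow, one_zpow, mul_one]
  -- Serre's formula for `Θ`
  obtain ⟨N₂, hN₂0, hN₂⟩ := IdelicCharacter.exists_pow_prod_map_localUnits_eq Θ hΘK S₀ hΘunits
  have hfilter0 : S₀.filter (fun w => ((p : ℕ) : 𝓞 ℚ) ∈ w.asIdeal) = {v} := by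
    ext w
    simp only [Finset.mem_filter, Finset.mem_singleton]
    exact ⟨fun h' => (natCast_natGenerator_mem_asIdeal_iff v w).mp h'.2,
      fun h' => ⟨by rw [h']; exact hvS₀, by rw [h']; exact hpv⟩⟩
  -- `Θ⟨p_w⟩_w^{N₂} = 1` for the good `w`
  have hΘq : ∀ w ∉ S₀,
      Θ (localUnits w (globalToLocalUnits w (Rat.primeUnit w))) ^ N₂ = 1 := by
    intro w hw
    have hwv : w ≠ v := (hgood w hw).2
    have hST : Disjoint S₀ {w} := Finset.disjoint_singleton_right.mpr hw
    have hk : ∀ w' ∈ S₀, ((p : ℕ) : 𝓞 ℚ) ∉ w'.asIdeal →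
        w'.valuation ℚ (Rat.primeUnit w : ℚ) = 1 := fun w' hw' _ =>
      valuation_primeUnit_of_ne fun h' => hw (h' ▸ hw')
    have hkT : ∀ w' ∉ S₀ ∪ {w}, w'.valuation ℚ (Rat.primeUnit w : ℚ) = 1 := by
      intro w' hw'
      rw [Finset.mem_union, Finset.mem_singleton, not_or] at hw'
      exact valuation_primeUnit_of_ne hw'.2
    have h1 := hN₂ (Rat.primeUnit w) hk {w} hST hkT
    rw [hfilter0, Finset.prod_singleton, Finset.prod_singleton] at h1
    -- the factor at `v` is trivial: `p_w` is a unit at `v`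
    have hval : Valued.v ((globalToLocalUnits v (Rat.primeUnit w) : (v.adicCompletion ℚ)ˣ) :
        v.adicCompletion ℚ) = 1 := by
      rw [val_globalToLocalUnits, valued_algebraMap_adicCompletion]
      exact valuation_primeUnit_of_ne hwv.symm
    obtain ⟨u, hu⟩ := IdelicCharacter.exists_unitsMap_eq_of_valued_eq_one _ hval
    rw [← hu, hΘv u, one_pow, one_mul] at h1
    exact h1
  -- Frobenius values at the good places
  have hfrobval : ∀ w ∉ S₀, ∀ 𝔓 ∈ w.primesAbove, ∀ Φ : absoluteGaloisGroup ℚ,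
      IsArithFrobAt (𝓞 ℚ) Φ 𝔓 →
        ((((ψ Φ : GL (Fin 1) (PadicAlgCl p)) : Matrix (Fin 1) (Fin 1) (PadicAlgCl p)) 0 0)) ^
            (b * N₁ * N₂) *
          (ιp (((GaloisRep.cyclotomicCharacter ℚ p Φ : ℤ_[p]ˣ) : ℤ_[p]) : ℚ_[p])) ^
            ((a : ℤ) * N₁ * N₂) = 1 := by
    intro w hw 𝔓 h𝔓 Φ hΦ
    have hwv : w ≠ v := (hgood w hw).2
    have hnot : ((p : ℕ) : 𝓞 ℚ) ∉ w.asIdeal := fun hmem =>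
      hwv ((natCast_natGenerator_mem_asIdeal_iff v w).mp hmem)
    -- `ψ(Φ) = Ψ⟨p_w⟩_w`
    have hψ := (FramedGaloisRep.hasFrobCharpolyAt_iff_of_rank_one ψ w _).mp
      ((hgood w hw).1.2.2 _ (valued_globalToLocalUnits_primeUnit w)) 𝔓 h𝔓 Φ hΦ
    -- `χ_ℓ(Φ) = p_w = Ψc⟨p_w⟩_w`
    have hχ := (FramedGaloisRep.hasFrobCharpolyAt_iff_of_rank_one cyc w _).mp
      (hasFrobCharpolyAt_natCast_of_cyclotomic cyc hcyc hnot) 𝔓 h𝔓 Φ hΦ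
    rw [hcyc Φ, Rat.residueCard_eq_natGenerator] at hχ
    have hΨc : ((Ψc (localUnits w (globalToLocalUnits w (Rat.primeUnit w))) : (PadicAlgCl p)ˣ) :
        PadicAlgCl p) = ιp (((GaloisRep.cyclotomicCharacter ℚ p Φ : ℤ_[p]ˣ) : ℤ_[p]) :
          ℚ_[p]) := by
      rw [hcfrob w hwv, ← hχ]
    have h1 := congrArg (fun u : (PadicAlgCl p)ˣ => (u : PadicAlgCl p)) (hΘq w hw)
    simp only [hΘ, Units.val_pow_eq_pow_val, Units.val_mul, Units.val_zpow_eq_zpow_val,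
      Units.val_one] at h1
    rw [← hψ, hΨc, mul_pow, ← pow_mul, ← zpow_natCast (_ ^ ((a : ℤ) * N₁)), ← zpow_mul] at h1
    exact h1
  -- Frobenius rigidity
  set Fgal : absoluteGaloisGroup ℚ →* (PadicAlgCl p)ˣ :=
    { toFun := fun σ => FramedRep.det ψ σ ^ (b * N₁ * N₂) *
        FramedRep.det cyc σ ^ ((a : ℤ) * N₁ * N₂)
      map_one' := by simp only [map_one, one_pow, one_zpow, mul_one]
      map_mul' := fun x y => by
        rw [map_mul, map_mul, mul_pow, mul_zpow, mul_mul_mul_comm] } with hFgal_def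
  have hFgal : ∀ σ, Fgal σ = FramedRep.det ψ σ ^ (b * N₁ * N₂) *
      FramedRep.det cyc σ ^ ((a : ℤ) * N₁ * N₂) := fun σ => rfl
  have hFgalc : Continuous Fgal :=
    ((FramedRep.det ψ).continuous.pow _).mul ((FramedRep.det cyc).continuous.zpow _)
  have hdens : LFunctions.NumberField.HasDirichletDensity ℚ
      {w : HeightOneSpectrum (𝓞 ℚ) | w ∉ S₀} 1 :=
    hasDirichletDensity_one_of_eventually (Filter.eventually_cofinite.mpr
      (S₀.finite_toSet.subset fun w hw => by simpa using hw))
  have hFgal1 := MonoidHom.eq_one_of_frobenius_eq_one_of_hasDirichletDensity_one Fgal hFgalc hdens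
    (fun w hw 𝔓 h𝔓 Φ hΦ => by
      apply Units.ext
      rw [hFgal, Units.val_mul, Units.val_pow_eq_pow_val, Units.val_zpow_eq_zpow_val,
        FramedGaloisRep.coe_det_apply_of_rank_one, FramedGaloisRep.coe_det_apply_of_rank_one,
        hcyc Φ, Units.val_one]
      exact hfrobval w hw 𝔓 h𝔓 Φ hΦ)
  refine ⟨b * N₁ * N₂, Nat.mul_pos (Nat.mul_pos hb hN₁0) hN₂0, -((a : ℤ) * N₁ * N₂), fun σ => ?_⟩
  have h1 := congrArg (fun u : (PadicAlgCl p)ˣ => (u : PadicAlgCl p)) (DFunLike.congr_fun hFgal1 σ)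
  simp only [hFgal, MonoidHom.one_apply, Units.val_mul, Units.val_pow_eq_pow_val,
    Units.val_zpow_eq_zpow_val, Units.val_one, FramedGaloisRep.coe_det_apply_of_rank_one,
    hcyc σ] at h1
  rw [zpow_neg]
  exact eq_inv_of_mul_eq_one_left h1

end FramedGaloisRep

end Literature.NumberTheory.GaloisRepresentations

end
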